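import Summits.Ventures.PercRepro.PuncturedLYMTwoCoHypGen

/-!
# PercRepro — TWO CO-HYPERPLANES OF ANY INTERSECTION, PART 2: THE MASTER LEMMA (p10, gen 35)

* `subset_of_aOf_eq_card` — `#(X ∩ C) = #C` forces `C ⊆ X`;
* `aOf_three_le_card`, `card_le_aOf_three` — the realisable profiles `(a, b, d)` of a set against three pairwise disjoint
  sets: `a + b + d ≤ #Z ≤ a + b + d + (n − #A − #B − #S)`;
* **`puncturedNMP_gen_of_seq`** — four nonnegative sequences in three indices with row sums `1` and column sums `#P/#Y`
  on the realisable profiles give `PuncturedNMP j (upLevel j (A ∪ S) ∪ upLevel j (B ∪ S))` for pairwise disjoint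
  `A, B, S` with `#A + #B + #S ≥ j + 2` — the gen-34 master lemma for two disjoint co-hyperplanes
  (`puncturedNMP_two_of_seq`, the case `S = ∅`) with one more index.
The sequences themselves are PuncturedLYMTwoCoHypGenSeq; nothing here asserts (SP), (PAV) or (NC).
-/

namespace PercRepro.PuncturedLYM

open Finset

variable {α : Type} [Fintype α] [DecidableEq α]

omit [Fintype α] in
/-- `#(X ∩ C) = #C` forces `C ⊆ X`. -/
theorem subset_of_aOf_eq_card {C X : Finset α} (h : aOf C X = C.card) : C ⊆ X := by
  unfold aOf at h
  have : X ∩ C = C := eq_of_subset_of_card_le inter_subset_right (le_of_eq h.symm)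
  exact inter_eq_right.1 this

omit [Fintype α] in
/-- `a + b + d ≤ #Z` for three pairwise disjoint sets. -/
theorem aOf_three_le_card {A B S Z : Finset α} (hAB : Disjoint A B) (hAS : Disjoint A S) (hBS : Disjoint B S) :
    aOf A Z + aOf B Z + aOf S Z ≤ Z.card := by
  have dAB : Disjoint (Z ∩ A) (Z ∩ B) := hAB.mono inter_subset_right inter_subset_right
  have dS : Disjoint ((Z ∩ A) ∪ (Z ∩ B)) (Z ∩ S) :=
    disjoint_union_left.2 ⟨hAS.mono inter_subset_right inter_subset_right,
      hBS.mono inter_subset_right inter_subset_right⟩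
  have e : (Z ∩ A) ∪ (Z ∩ B) ∪ (Z ∩ S) = Z ∩ (A ∪ B ∪ S) := by
    rw [← inter_union_distrib_left, ← inter_union_distrib_left]
  have h := card_union_of_disjoint dS
  rw [card_union_of_disjoint dAB, e] at h
  have := card_le_card (inter_subset_left (s₁ := Z) (s₂ := A ∪ B ∪ S))
  unfold aOf
  omega

/-- `#Z ≤ a + b + d + (n − #A − #B − #S)` for three pairwise disjoint sets. -/
theorem card_le_aOf_three {A B S Z : Finset α} (hAB : Disjoint A B) (hAS : Disjoint A S) (hBS : Disjoint B S) :
    Z.card ≤ aOf A Z + aOf B Z + aOf S Z + (Fintype.card α - A.card - B.card - S.card) := by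
  have dAB : Disjoint (Z ∩ A) (Z ∩ B) := hAB.mono inter_subset_right inter_subset_right
  have dS : Disjoint ((Z ∩ A) ∪ (Z ∩ B)) (Z ∩ S) :=
    disjoint_union_left.2 ⟨hAS.mono inter_subset_right inter_subset_right,
      hBS.mono inter_subset_right inter_subset_right⟩
  have e : (Z ∩ A) ∪ (Z ∩ B) ∪ (Z ∩ S) = Z ∩ (A ∪ B ∪ S) := by
    rw [← inter_union_distrib_left, ← inter_union_distrib_left]
  have h := card_union_of_disjoint dS
  rw [card_union_of_disjoint dAB, e] at h
  have h2 := card_sdiff_add_card_inter Z (A ∪ B ∪ S)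
  have h3 : (Z \ (A ∪ B ∪ S)).card ≤ (univ \ (A ∪ B ∪ S)).card :=
    card_le_card (sdiff_subset_sdiff (subset_univ Z) subset_rfl)
  have hU : (A ∪ B ∪ S).card = A.card + B.card + S.card := by
    rw [card_union_of_disjoint (disjoint_union_left.2 ⟨hAS, hBS⟩), card_union_of_disjoint hAB]
  rw [card_univ_sdiff, hU] at h3
  unfold aOf
  omega

/-- **(SP) for `upLevel j (A ∪ S) ∪ upLevel j (B ∪ S)` from four sequences** (`A, B, S` pairwise disjoint,
`#A + #B + #S ≥ j + 2`, `j < n`): nonnegative on the profiles of `P` (`a ≤ #A`, `b ≤ #B`, `d ≤ #S`, not both `a = #A`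
and `d = #S`, not both `b = #B` and `d = #S`); row sums `1` on the realisable profiles; column sums `k = #P/#Y` on the
realisable untouched `(j+1)`-profiles, and on the touched ones `#A·wA (#A−1) b' #S + #S·wD #A b' (#S−1) = k`
(`b' < #B`), `#B·wB a' (#B−1) #S + #S·wD a' #B (#S−1) = k` (`a' < #A`). -/
theorem puncturedNMP_gen_of_seq {j : ℕ} {A B S : Finset α} (hjn : j < Fintype.card α) (hAB : Disjoint A B)
    (hAS : Disjoint A S) (hBS : Disjoint B S) (hbig : j + 2 ≤ A.card + B.card + S.card)
    (wA wB wD wR : ℕ → ℕ → ℕ → ℚ) (k : ℚ)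
    (hk : k * (levelAbove α j).card = (punctured j (upLevel j (A ∪ S) ∪ upLevel j (B ∪ S))).card)
    (hnn : ∀ a b d, a ≤ A.card → b ≤ B.card → d ≤ S.card → ¬ (a = A.card ∧ d = S.card) →
      ¬ (b = B.card ∧ d = S.card) → 0 ≤ wA a b d ∧ 0 ≤ wB a b d ∧ 0 ≤ wD a b d ∧ 0 ≤ wR a b d)
    (hrow : ∀ a b d, a ≤ A.card → b ≤ B.card → d ≤ S.card → ¬ (a = A.card ∧ d = S.card) →
      ¬ (b = B.card ∧ d = S.card) → a + b + d ≤ j → j ≤ a + b + d + (Fintype.card α - A.card - B.card - S.card) →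
      ((A.card : ℚ) - a) * wA a b d + ((B.card : ℚ) - b) * wB a b d + ((S.card : ℚ) - d) * wD a b d +
        ((Fintype.card α : ℚ) - j - A.card - B.card - S.card + a + b + d) * wR a b d = 1)
    (hcol : ∀ a' b' d', a' ≤ A.card → b' ≤ B.card → d' ≤ S.card → ¬ (a' = A.card ∧ d' = S.card) →
      ¬ (b' = B.card ∧ d' = S.card) → a' + b' + d' ≤ j + 1 →
      j + 1 ≤ a' + b' + d' + (Fintype.card α - A.card - B.card - S.card) →
      (a' : ℚ) * wA (a' - 1) b' d' + (b' : ℚ) * wB a' (b' - 1) d' + (d' : ℚ) * wD a' b' (d' - 1) +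
        ((j : ℚ) + 1 - a' - b' - d') * wR a' b' d' = k)
    (htop₁ : ∀ b', b' < B.card → A.card + b' + S.card ≤ j + 1 →
      j + 1 ≤ A.card + b' + S.card + (Fintype.card α - A.card - B.card - S.card) →
      (A.card : ℚ) * wA (A.card - 1) b' S.card + (S.card : ℚ) * wD A.card b' (S.card - 1) = k)
    (htop₂ : ∀ a', a' < A.card → a' + B.card + S.card ≤ j + 1 →
      j + 1 ≤ a' + B.card + S.card + (Fintype.card α - A.card - B.card - S.card) →
      (B.card : ℚ) * wB a' (B.card - 1) S.card + (S.card : ℚ) * wD a' B.card (S.card - 1) = k) :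
    PuncturedNMP j (upLevel j (A ∪ S) ∪ upLevel j (B ∪ S)) := by
  intro 𝒜 h𝒜
  rcases Nat.eq_zero_or_pos (punctured j (upLevel j (A ∪ S) ∪ upLevel j (B ∪ S))).card with hP | hP
  · have : 𝒜 = ∅ := subset_empty.1 (card_eq_zero.1 hP ▸ h𝒜)
    subst this
    simp
  have hYpos : (0 : ℚ) < (levelAbove α j).card := by exact_mod_cast card_levelAbove_pos hjn
  have hPpos : (0 : ℚ) < (punctured j (upLevel j (A ∪ S) ∪ upLevel j (B ∪ S))).card := by exact_mod_cast hP
  have hkpos : 0 < k := by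
    by_contra h
    have : k * (levelAbove α j).card ≤ 0 := mul_nonpos_of_nonpos_of_nonneg (not_lt.1 h) hYpos.le
    linarith
  -- the domain facts for a set containing neither `A ∪ S` nor `B ∪ S`
  have hdom : ∀ Z : Finset α, ¬ A ∪ S ⊆ Z → ¬ B ∪ S ⊆ Z →
      aOf A Z ≤ A.card ∧ aOf B Z ≤ B.card ∧ aOf S Z ≤ S.card ∧
        ¬ (aOf A Z = A.card ∧ aOf S Z = S.card) ∧ ¬ (aOf B Z = B.card ∧ aOf S Z = S.card) := by
    intro Z h1 h2
    refine ⟨card_le_card inter_subset_right, card_le_card inter_subset_right, card_le_card inter_subset_right,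
      ?_, ?_⟩
    · rintro ⟨ha, hd⟩
      exact h1 (union_subset (subset_of_aOf_eq_card ha) (subset_of_aOf_eq_card hd))
    · rintro ⟨hb, hd⟩
      exact h2 (union_subset (subset_of_aOf_eq_card hb) (subset_of_aOf_eq_card hd))
  refine puncturedNMP_of_weights (fun X Y => hW3p wA wB wD wR A B S X Y / k) ?_ ?_ ?_ 𝒜 h𝒜
  · -- nonnegativity
    intro X hX Y hY
    obtain ⟨hXc, hC1, hC2⟩ := mem_punctured_union_upLevel.1 hX
    rw [sups_eq hXc] at hY
    obtain ⟨y, hy, rfl⟩ := mem_image.1 hY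
    rw [hW3p_insert wA wB wD wR A B S X (mem_sdiff.1 hy).2]
    apply div_nonneg _ hkpos.le
    unfold hW3
    obtain ⟨ha, hb, hd, h1, h2⟩ := hdom X hC1 hC2
    split_ifs
    · exact (hnn _ _ _ ha hb hd h1 h2).1
    · exact (hnn _ _ _ ha hb hd h1 h2).2.1
    · exact (hnn _ _ _ ha hb hd h1 h2).2.2.1
    · exact (hnn _ _ _ ha hb hd h1 h2).2.2.2
  · -- row sums
    intro X hX
    obtain ⟨hXc, hC1, hC2⟩ := mem_punctured_union_upLevel.1 hX
    obtain ⟨ha, hb, hd, h1, h2⟩ := hdom X hC1 hC2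
    have hab := aOf_three_le_card (Z := X) hAB hAS hBS
    have hab' := card_le_aOf_three (Z := X) hAB hAS hBS
    rw [hXc] at hab hab'
    rw [← sum_div, sum_sups_hW3 wA wB wD wR hAB hAS hBS hXc, hrow _ _ _ ha hb hd h1 h2 hab hab']
    rw [div_le_div_iff₀ hPpos hkpos, one_mul, ← hk]
    exact le_of_eq (mul_comm _ _)
  · -- column sums
    intro Y hY
    rw [mem_levelAbove] at hY
    rw [← sum_div, div_le_one hkpos]
    have hab := aOf_three_le_card (Z := Y) hAB hAS hBS
    have hab' := card_le_aOf_three (Z := Y) hAB hAS hBS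
    rw [hY] at hab hab'
    have hnot : ¬ (A ∪ S ⊆ Y ∧ B ∪ S ⊆ Y) := by
      rintro ⟨h1, h2⟩
      have hsub : A ∪ B ∪ S ⊆ Y := by
        intro z hz
        rcases mem_union.1 hz with hz | hz
        · rcases mem_union.1 hz with hz | hz
          · exact h1 (mem_union_left S hz)
          · exact h2 (mem_union_left S hz)
        · exact h1 (mem_union_right A hz)
      have := card_le_card hsub
      rw [card_union_of_disjoint (disjoint_union_left.2 ⟨hAS, hBS⟩), card_union_of_disjoint hAB, hY] at this
      omega
    by_cases h1 : A ∪ S ⊆ Y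
    · have h2 : ¬ B ∪ S ⊆ Y := fun h2 => hnot ⟨h1, h2⟩
      rw [sum_subsP_hW3_top₁ wA wB wD wR hAB hAS hBS hY h1 h2]
      have hYA : aOf A Y = A.card := by
        unfold aOf
        rw [inter_eq_right.2 (subset_union_left.trans h1)]
      have hYS : aOf S Y = S.card := by
        unfold aOf
        rw [inter_eq_right.2 (subset_union_right.trans h1)]
      have hYB : aOf B Y < B.card := by
        apply aOf_lt_card
        intro hB
        exact h2 (union_subset hB (subset_union_right.trans h1))
      rw [hYA, hYS] at hab hab'
      exact le_of_eq (htop₁ _ hYB hab hab')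
    · by_cases h2 : B ∪ S ⊆ Y
      · rw [sum_subsP_hW3_top₂ wA wB wD wR hAB hAS hBS hY h1 h2]
        have hYB : aOf B Y = B.card := by
          unfold aOf
          rw [inter_eq_right.2 (subset_union_left.trans h2)]
        have hYS : aOf S Y = S.card := by
          unfold aOf
          rw [inter_eq_right.2 (subset_union_right.trans h2)]
        have hYA : aOf A Y < A.card := by
          apply aOf_lt_card
          intro hA
          exact h1 (union_subset hA (subset_union_right.trans h2))
        rw [hYB, hYS] at hab hab'
        exact le_of_eq (htop₂ _ hYA hab hab')
      · rw [sum_subsP_hW3_untouched wA wB wD wR hAB hAS hBS hY h1 h2]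
        obtain ⟨ha, hb, hd, hd1, hd2⟩ := hdom Y h1 h2
        exact le_of_eq (hcol _ _ _ ha hb hd hd1 hd2 hab hab')

end PercRepro.PuncturedLYM
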